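import Literature.AnabelianGeometry.EtaleTheta.SettingModelSemidirect
import Literature.AnabelianGeometry.SemiGraphs.TemperedGroups
import HarnessLib

/-!
# Root models of [EtTh] §1: a semidirect product `N ⋊_φ G` of a TEMPERED group by a PROFINITE group is tempered
# (proof-only plumbing for the χ-twisted model `Π^tp_X := Γ ⋊_χ G_{ℚ_p}`, R78 reshape (B))

Mochizuki, *Semi-graphs of anabelioids*, Publ. RIMS **42** (2006) [SemiAnbd], Def. 3.1 (i) p. 33 (tempered groups:
«an inverse limit of an inverse system of surjections of countable discrete topological groups»), Rmk. 3.1.1 («every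
profinite group is tempered»), Ex. 3.10 p. 43 («`1 → π₁^temp(X_K̄) → π₁^temp(X_K) → G_K → 1`» — a tempered group that
is an extension of a profinite group by a tempered group) [cite: MochizukiSemiAnbd2006, Def 3.1(i) p.33]; [EtTh] §1
p. 12 (`Π^tp_X ↠ G_K`).  abc-iut cell, seat abc-iut-w5-d111 (gen 3); PROOF-ONLY (no definition), over abc-iut-L2-t1's
carrier-free plumbing `twistedProd A B` (`SettingModelSemidirect.lean`: the subgroups `A ⋊ B ≤ N ⋊_φ G`, their
NORMALITY criterion and OPENNESS) and the tree's intrinsic `IsTempered` (`TemperedGroups.lean`).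

THE LEMMA (`isTempered_semidirect`).  Let `N` be tempered, `G` profinite (compact, Hausdorff, totally disconnected),
`φ : G →* MulAut N`, and let `N ⋊[φ] G` carry ANY group topology for which `g ↦ (g.left, g.right)` is a topological
embedding (`IsInducing`; the χ-model topologises `Γ ⋊ G_{ℚ_p}` exactly so).  Suppose
  (T) every open normal subgroup `N₁ ≤ N` contains an open normal `N₂` that is stable under ALL of `φ(G)` and modulo
      which some open normal `W ≤ G` acts trivially (`n · (φ_w n)⁻¹ ∈ N₂`).
Then `N ⋊[φ] G` is tempered: the subgroups `N₂ ⋊ W` are open normal of countable index and cofinal (basis), they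
separate points, and compatible coset families come from elements (completeness: the `G`-coordinate by the
completeness of the profinite `G`, the `N`-coordinate by the completeness of `N` applied to the family read off the
representatives with `G`-coordinate normalised to the limit).
WHY (T) IS NEEDED (numbers, not opinion): for the countable discrete `N = ⊕_ℕ ℤ/3` and `G = ∏_ℕ ℤ/2` acting by
coordinatewise inversion (jointly continuous), `N ⋊ G` has NO open normal subgroup inside the neighbourhood `1 × G`
of `1`, so it is not tempered although `N` and `G` are; (T) fails there (no open `W` acts trivially on `N`).  At the
χ-model (T) holds because the twist acts through the finite levels `F̂₂/V` and fixes the degree.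
Consequence for the cell: the `isTempered` field of `TemperedCurve.GroupLevelData (curveχ p)` (ruling η′), after which
this seat's `ThetaSetting.isCompact_deltaTheta_of_groupLevelData d hYcl` (p425959) applies at the χ-model.
Classical topological group theory; nothing of [EtTh] asserted; no side taken on [IUTchIII] Cor. 3.12.
-/

namespace Literature.AnabelianGeometry.EtaleTheta.SettingModel.Semidirect

open Literature.AnabelianGeometry.SemiGraphs
open _root_.Topology _root_.Filter

variable {N G : Type*} [Group N] [Group G] {φ : G →* MulAut N}

/-- The open normal subgroup `A ⋊ W ≤ N ⋊_φ G` for an open normal `φ(G)`-stable `A ⊴ N` and an open normal `W ⊴ G`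
acting trivially modulo `A` (abc-iut-L2-t1's `twistedProd` with its normality and openness lemmas), packaged as an
`OpenNormalSubgroup`. [cite: MochizukiSemiAnbd2006, Def 3.1(i) p.33] -/
theorem exists_openNormalSubgroup_twistedProd [TopologicalSpace N] [TopologicalSpace G]
    [TopologicalSpace (N ⋊[φ] G)] (hc : Continuous fun g : N ⋊[φ] G => (g.left, g.right))
    (A : OpenNormalSubgroup N) (W : OpenNormalSubgroup G)
    (hstab : ∀ g : G, ∀ ⦃a⦄, a ∈ (A : Subgroup N) → φ g a ∈ (A : Subgroup N))
    (htriv : ∀ ⦃b⦄, b ∈ (W : Subgroup G) → ∀ n : N, n * (φ b n)⁻¹ ∈ (A : Subgroup N)) :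
    ∃ M : OpenNormalSubgroup (N ⋊[φ] G), ∀ g : N ⋊[φ] G, g ∈ M ↔ g.left ∈ A ∧ g.right ∈ W := by
  haveI : (twistedProd (A : Subgroup N) (W : Subgroup G) (stable_of_forall hstab _)).Normal :=
    twistedProd_normal hstab htriv
  exact ⟨{ toSubgroup := twistedProd (A : Subgroup N) (W : Subgroup G) (stable_of_forall hstab _)
           isOpen' := isOpen_twistedProd hc A.isOpen W.isOpen
           isNormal' := inferInstance }, fun g => Iff.rfl⟩

/-- In `N ⋊_φ G`, for a `φ(G)`-stable `A ≤ N`: `x⁻¹ y ∈ A ⋊ W` iff `x.left⁻¹ y.left ∈ A` and `x.right⁻¹ y.right ∈ W`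
(the twist `φ(x.right⁻¹)` is undone by stability). [cite: MochizukiSemiAnbd2006, Def 3.1(i) p.33] -/
theorem inv_mul_mem_iff_of_stable {A : Subgroup N} {B : Subgroup G}
    (hstab : ∀ g : G, ∀ ⦃a⦄, a ∈ A → φ g a ∈ A) (x y : N ⋊[φ] G) :
    ((x⁻¹ * y).left ∈ A ∧ (x⁻¹ * y).right ∈ B) ↔ (x.left⁻¹ * y.left ∈ A ∧ x.right⁻¹ * y.right ∈ B) := by
  have hl : (x⁻¹ * y).left = φ x.right⁻¹ (x.left⁻¹ * y.left) := by
    rw [SemidirectProduct.mul_left, SemidirectProduct.inv_left, SemidirectProduct.inv_right, map_mul]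
  have hr : (x⁻¹ * y).right = x.right⁻¹ * y.right := by
    rw [SemidirectProduct.mul_right, SemidirectProduct.inv_right]
  rw [hl, hr]
  refine ⟨fun h => ⟨?_, h.2⟩, fun h => ⟨hstab _ h.1, h.2⟩⟩
  have h1 := hstab x.right h.1
  rwa [← MulAut.mul_apply, ← map_mul, mul_inv_cancel, map_one, MulAut.one_apply] at h1

/-- **A semidirect product of a tempered group by a profinite group is tempered** (under the pro-discrete continuity
(T) of the action; see the module docstring).  [SemiAnbd] Def. 3.1 (i), Rmk. 3.1.1, Ex. 3.10 («`Π^temp` … `G_K`»).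
[cite: MochizukiSemiAnbd2006, Def 3.1(i) p.33] -/
theorem isTempered_semidirect [TopologicalSpace N] [IsTopologicalGroup N] [TopologicalSpace G]
    [IsTopologicalGroup G] [CompactSpace G] [T2Space G] [TotallyDisconnectedSpace G]
    [TopologicalSpace (N ⋊[φ] G)] [IsTopologicalGroup (N ⋊[φ] G)]
    (hι : IsInducing fun g : N ⋊[φ] G => (g.left, g.right)) (hN : IsTempered N)
    (hT : ∀ N₁ : OpenNormalSubgroup N, ∃ N₂ : OpenNormalSubgroup N, N₂ ≤ N₁ ∧
      (∀ g : G, ∀ ⦃a⦄, a ∈ (N₂ : Subgroup N) → φ g a ∈ (N₂ : Subgroup N)) ∧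
      ∃ W : OpenNormalSubgroup G, ∀ ⦃b⦄, b ∈ (W : Subgroup G) → ∀ n : N, n * (φ b n)⁻¹ ∈ (N₂ : Subgroup N)) :
    IsTempered (N ⋊[φ] G) := by
  classical
  have hc : Continuous fun g : N ⋊[φ] G => (g.left, g.right) := hι.continuous
  have hG : IsTempered G := IsTempered.of_profinite
  -- choose, for every open normal `N₁ ≤ N`, a good `N₂(N₁) ≤ N₁` with its `W(N₁)`
  choose N₂ hN₂le hN₂stab W hWtriv using hT
  -- neighbourhoods of `1` in `N ⋊ G` contain boxes
  have hbox : ∀ U ∈ 𝓝 (1 : N ⋊[φ] G), ∃ U₁ ∈ 𝓝 (1 : N), ∃ U₂ : Set G, IsOpen U₂ ∧ (1 : G) ∈ U₂ ∧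
      ∀ g : N ⋊[φ] G, g.left ∈ U₁ → g.right ∈ U₂ → g ∈ U := by
    intro U hU
    rw [hι.nhds_eq_comap, Filter.mem_comap] at hU
    obtain ⟨V, hV, hVU⟩ := hU
    have hV' : V ∈ 𝓝 ((1 : N), (1 : G)) := by
      simpa [SemidirectProduct.one_left, SemidirectProduct.one_right] using hV
    obtain ⟨u, v, hu, h1u, hv, h1v, huv⟩ := mem_nhds_prod_iff'.mp hV'
    exact ⟨u, hu.mem_nhds h1u, v, hv, h1v, fun g hg1 hg2 => hVU (huv (Set.mk_mem_prod hg1 hg2))⟩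
  refine ⟨fun U hU => ?_, fun g hg => ?_, fun x hx => ?_⟩
  · /- (a) basis -/
    obtain ⟨U₁, hU₁, U₂, hU₂o, h1U₂, hUsub⟩ := hbox U hU
    obtain ⟨N₁, -, hN₁U⟩ := hN.basis U₁ hU₁
    obtain ⟨W₀, hW₀⟩ := ProfiniteGrp.exist_openNormalSubgroup_sub_open_nhds_of_one hU₂o h1U₂
    -- shrink `W(N₁)` inside `U₂`
    obtain ⟨W', hW'⟩ := ProfiniteGrp.exist_openNormalSubgroup_sub_open_nhds_of_one
      (((W N₁).isOpen).inter W₀.isOpen) ⟨(W N₁).toSubgroup.one_mem, W₀.toSubgroup.one_mem⟩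
    have hW'triv : ∀ ⦃b⦄, b ∈ (W' : Subgroup G) → ∀ n : N, n * (φ b n)⁻¹ ∈ (N₂ N₁ : Subgroup N) :=
      fun b hb n => hWtriv N₁ (hW' hb).1 n
    obtain ⟨M, hM⟩ := exists_openNormalSubgroup_twistedProd hc (N₂ N₁) W' (hN₂stab N₁) hW'triv
    refine ⟨M, ?_, fun g hg => ?_⟩
    · -- countable index: `(N ⋊ G)/M ↪ N/N₂ × G/W'`
      haveI : Countable (N ⧸ (N₂ N₁).toSubgroup) := hN.countable_quotient _ (N₂ N₁).isOpen
      haveI : Countable (G ⧸ W'.toSubgroup) := hG.countable_quotient _ W'.isOpen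
      let f : (N ⋊[φ] G) ⧸ M.toSubgroup → (N ⧸ (N₂ N₁).toSubgroup) × (G ⧸ W'.toSubgroup) :=
        Quotient.lift (fun g : N ⋊[φ] G => ((g.left : N ⧸ (N₂ N₁).toSubgroup), (g.right : G ⧸ W'.toSubgroup)))
          (by
            intro x y hxy
            have hxy' : x⁻¹ * y ∈ M := QuotientGroup.leftRel_apply.mp hxy
            have h := (inv_mul_mem_iff_of_stable (B := (W' : Subgroup G)) (hN₂stab N₁) x y).mp ((hM _).mp hxy')
            exact Prod.ext (QuotientGroup.eq.mpr h.1) (QuotientGroup.eq.mpr h.2))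
      have hf : Function.Injective f := by
        rintro ⟨x⟩ ⟨y⟩ hxy
        have h1 : (x.left : N ⧸ (N₂ N₁).toSubgroup) = y.left := congrArg Prod.fst hxy
        have h2 : (x.right : G ⧸ W'.toSubgroup) = y.right := congrArg Prod.snd hxy
        exact Quotient.sound ((QuotientGroup.leftRel_apply).mpr ((hM _).mpr
          ((inv_mul_mem_iff_of_stable (B := (W' : Subgroup G)) (hN₂stab N₁) x y).mpr
            ⟨QuotientGroup.eq.mp h1, QuotientGroup.eq.mp h2⟩)))
      exact hf.countable
    · rw [SetLike.mem_coe, hM] at hg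
      exact hUsub g (hN₁U (hN₂le N₁ hg.1)) (hW₀ (hW' hg.2).2)
  · /- (b) separation -/
    by_cases hr : g.right = 1
    · have hl : g.left ≠ 1 := by
        intro hl
        exact hg (SemidirectProduct.ext hl hr)
      obtain ⟨N₁, hN₁⟩ := hN.separated g.left hl
      obtain ⟨M, hM⟩ := exists_openNormalSubgroup_twistedProd hc (N₂ N₁) (W N₁) (hN₂stab N₁) (hWtriv N₁)
      refine ⟨M, fun hgM => hN₁ ?_⟩
      exact hN₂le N₁ (((hM g).mp hgM).1)
    · obtain ⟨W₁, hW₁⟩ := ProfiniteGrp.exist_openNormalSubgroup_sub_open_nhds_of_one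
        (isOpen_compl_singleton (x := g.right)) (by simpa using fun h => hr h.symm)
      -- `⊤ ⋊ W₁`
      obtain ⟨T, hTtop⟩ : ∃ T : OpenNormalSubgroup N, (T : Subgroup N) = ⊤ :=
        ⟨{ toSubgroup := ⊤, isOpen' := isOpen_univ, isNormal' := inferInstance }, rfl⟩
      have hstab : ∀ g' : G, ∀ ⦃a⦄, a ∈ (T : Subgroup N) → φ g' a ∈ (T : Subgroup N) := by
        intro g' a _; rw [hTtop]; exact Subgroup.mem_top _
      have htriv : ∀ ⦃b⦄, b ∈ (W₁ : Subgroup G) → ∀ n : N, n * (φ b n)⁻¹ ∈ (T : Subgroup N) := by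
        intro b _ n; rw [hTtop]; exact Subgroup.mem_top _
      obtain ⟨M, hM⟩ := exists_openNormalSubgroup_twistedProd hc T W₁ hstab htriv
      refine ⟨M, fun hgM => hW₁ (((hM g).mp hgM).2) rfl⟩
  · /- (c) completeness -/
    -- (c1) the `G`-coordinate: the family `rightHom (x (⊤ ⋊ W))` is compatible, so comes from some `k ∈ G`
    obtain ⟨T, hTtop⟩ : ∃ T : OpenNormalSubgroup N, (T : Subgroup N) = ⊤ :=
      ⟨{ toSubgroup := ⊤, isOpen' := isOpen_univ, isNormal' := inferInstance }, rfl⟩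
    have hTstab : ∀ g' : G, ∀ ⦃a⦄, a ∈ (T : Subgroup N) → φ g' a ∈ (T : Subgroup N) := by
      intro g' a _; rw [hTtop]; exact Subgroup.mem_top _
    have hTtriv : ∀ (W₁ : OpenNormalSubgroup G) ⦃b⦄, b ∈ (W₁ : Subgroup G) → ∀ n : N,
        n * (φ b n)⁻¹ ∈ (T : Subgroup N) := by
      intro W₁ b _ n; rw [hTtop]; exact Subgroup.mem_top _
    choose MW hMW using fun W₁ : OpenNormalSubgroup G =>
      exists_openNormalSubgroup_twistedProd hc T W₁ hTstab (hTtriv W₁)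
    -- representatives
    have hrep : ∀ M : OpenNormalSubgroup (N ⋊[φ] G), x M = ((x M).out : N ⋊[φ] G) := fun M => (Quotient.out_eq _).symm
    -- the induced family on `G`
    let y : (W₁ : OpenNormalSubgroup G) → G ⧸ W₁.toSubgroup := fun W₁ => ((x (MW W₁)).out.right : G ⧸ W₁.toSubgroup)
    have hyrep : ∀ (W₁ : OpenNormalSubgroup G) (g : N ⋊[φ] G), x (MW W₁) = (g : (N ⋊[φ] G) ⧸ (MW W₁).toSubgroup) →
        y W₁ = (g.right : G ⧸ W₁.toSubgroup) := by
      intro W₁ g hg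
      have h := hg.symm.trans (hrep (MW W₁))
      rw [QuotientGroup.eq] at h
      have h2 := ((hMW W₁ _).mp h).2
      rw [SemidirectProduct.mul_right, SemidirectProduct.inv_right] at h2
      exact (QuotientGroup.eq.mpr h2).symm
    have hy : ∀ W₁ W₂ : OpenNormalSubgroup G, W₁ ≤ W₂ → ∀ g : G,
        y W₁ = (g : G ⧸ W₁.toSubgroup) → y W₂ = (g : G ⧸ W₂.toSubgroup) := by
      intro W₁ W₂ hle g hg
      -- `MW W₁ ≤ MW W₂`
      have hMle : MW W₁ ≤ MW W₂ := by
        intro z hz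
        exact (hMW W₂ z).mpr ⟨((hMW W₁ z).mp hz).1, hle ((hMW W₁ z).mp hz).2⟩
      -- a representative of `x (MW W₁)` with right part `g`
      set r := (x (MW W₁)).out with hr
      have hgr : r.right⁻¹ * g ∈ (W₁ : Subgroup G) := by
        have := hyrep W₁ r (hrep _)
        rw [this] at hg
        exact QuotientGroup.eq.mp hg
      let r' : N ⋊[φ] G := r * SemidirectProduct.inr (r.right⁻¹ * g)
      have hr'right : r'.right = g := by
        show (r * SemidirectProduct.inr (r.right⁻¹ * g)).right = g
        rw [SemidirectProduct.mul_right, SemidirectProduct.right_inr, mul_inv_cancel_left]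
      have hxr' : x (MW W₁) = (r' : (N ⋊[φ] G) ⧸ (MW W₁).toSubgroup) := by
        rw [hrep (MW W₁), ← hr]
        apply QuotientGroup.eq.mpr
        refine (hMW W₁ _).mpr ⟨?_, ?_⟩
        · show (r⁻¹ * r').left ∈ (T : Subgroup N)
          rw [hTtop]; exact Subgroup.mem_top _
        · show (r⁻¹ * (r * SemidirectProduct.inr (r.right⁻¹ * g))).right ∈ (W₁ : Subgroup G)
          rw [inv_mul_cancel_left, SemidirectProduct.right_inr]
          exact hgr
      have h2 := hyrep W₂ r' (hx _ _ hMle r' hxr')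
      rw [h2, hr'right]
    obtain ⟨k, hk⟩ := hG.complete y hy
    -- (c2) the `N`-coordinate: representatives at `M(N₁) := N₂(N₁) ⋊ W(N₁)`
    choose M hM using fun N₁ : OpenNormalSubgroup N =>
      exists_openNormalSubgroup_twistedProd hc (N₂ N₁) (W N₁) (hN₂stab N₁) (hWtriv N₁)
    -- compatibility of two representatives through the intersection
    have hcomp : ∀ (N₁ N₁' : OpenNormalSubgroup N),
        ((x (M N₁)).out.left)⁻¹ * (x (M N₁')).out.left ∈ ((N₂ N₁ : Subgroup N) ⊔ (N₂ N₁' : Subgroup N)) := by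
      intro N₁ N₁'
      set r₀ := (x (M N₁ ⊓ M N₁')).out with hr₀
      have h1 : x (M N₁) = (r₀ : (N ⋊[φ] G) ⧸ (M N₁).toSubgroup) := hx _ _ inf_le_left r₀ (hrep _)
      have h2 : x (M N₁') = (r₀ : (N ⋊[φ] G) ⧸ (M N₁').toSubgroup) := hx _ _ inf_le_right r₀ (hrep _)
      rw [hrep (M N₁), QuotientGroup.eq] at h1
      rw [hrep (M N₁'), QuotientGroup.eq] at h2
      have h1' := ((inv_mul_mem_iff_of_stable (B := (W N₁ : Subgroup G)) (hN₂stab N₁) _ _).mp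
        ((hM N₁ _).mp h1)).1
      have h2' := ((inv_mul_mem_iff_of_stable (B := (W N₁' : Subgroup G)) (hN₂stab N₁') _ _).mp
        ((hM N₁' _).mp h2)).1
      -- `a⁻¹ r₀ ∈ N₂`, `b⁻¹ r₀ ∈ N₂'` ⇒ `a⁻¹ b = (a⁻¹ r₀) (b⁻¹ r₀)⁻¹`
      have e : ((x (M N₁)).out.left)⁻¹ * (x (M N₁')).out.left =
          (((x (M N₁)).out.left)⁻¹ * r₀.left) * (((x (M N₁')).out.left)⁻¹ * r₀.left)⁻¹ := by group
      rw [e]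
      exact Subgroup.mul_mem _ (Subgroup.mem_sup_left h1') (Subgroup.inv_mem _ (Subgroup.mem_sup_right h2'))
    let z : (N₁ : OpenNormalSubgroup N) → N ⧸ N₁.toSubgroup := fun N₁ => ((x (M N₁)).out.left : N ⧸ N₁.toSubgroup)
    have hz : ∀ N₁ N₁' : OpenNormalSubgroup N, N₁ ≤ N₁' → ∀ n : N,
        z N₁ = (n : N ⧸ N₁.toSubgroup) → z N₁' = (n : N ⧸ N₁'.toSubgroup) := by
      intro N₁ N₁' hle n hn
      have h1 : ((x (M N₁)).out.left)⁻¹ * n ∈ (N₁ : Subgroup N) := QuotientGroup.eq.mp hn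
      apply QuotientGroup.eq.mpr
      have hsup : (N₂ N₁ : Subgroup N) ⊔ (N₂ N₁' : Subgroup N) ≤ (N₁' : Subgroup N) :=
        sup_le (le_trans (hN₂le N₁) hle) (hN₂le N₁')
      have h2 := hsup (hcomp N₁ N₁')
      have e : ((x (M N₁')).out.left)⁻¹ * n =
          (((x (M N₁)).out.left)⁻¹ * (x (M N₁')).out.left)⁻¹ * (((x (M N₁)).out.left)⁻¹ * n) := by group
      rw [e]
      exact Subgroup.mul_mem _ (Subgroup.inv_mem _ h2) (hle h1)
    obtain ⟨n, hn⟩ := hN.complete z hz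
    -- `n ≡ rep(N₂ N₁).left  (mod N₂ N₁)` for every `N₁` (apply the limit at the index `N₂ N₁` and compare)
    have hnN₂ : ∀ N₁ : OpenNormalSubgroup N, ((x (M N₁)).out.left)⁻¹ * n ∈ (N₂ N₁ : Subgroup N) := by
      intro N₁
      have h1 : ((x (M (N₂ N₁))).out.left)⁻¹ * n ∈ (N₂ N₁ : Subgroup N) := QuotientGroup.eq.mp (hn (N₂ N₁))
      have hsup : (N₂ N₁ : Subgroup N) ⊔ (N₂ (N₂ N₁) : Subgroup N) ≤ (N₂ N₁ : Subgroup N) :=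
        sup_le le_rfl (hN₂le (N₂ N₁))
      have h2 := hsup (hcomp N₁ (N₂ N₁))
      have e : ((x (M N₁)).out.left)⁻¹ * n =
          (((x (M N₁)).out.left)⁻¹ * (x (M (N₂ N₁))).out.left) * (((x (M (N₂ N₁))).out.left)⁻¹ * n) := by group
      rw [e]
      exact Subgroup.mul_mem _ h2 h1
    -- (c3) the element `⟨n, k⟩` represents every `x M'`
    refine ⟨⟨n, k⟩, fun M' => ?_⟩
    obtain ⟨U₁, hU₁, U₂, hU₂o, h1U₂, hUsub⟩ := hbox _ (M'.toOpenSubgroup.mem_nhds_one)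
    obtain ⟨N₁, -, hN₁U⟩ := hN.basis U₁ hU₁
    obtain ⟨W₀, hW₀⟩ := ProfiniteGrp.exist_openNormalSubgroup_sub_open_nhds_of_one hU₂o h1U₂
    obtain ⟨W', hW'⟩ := ProfiniteGrp.exist_openNormalSubgroup_sub_open_nhds_of_one
      (((W N₁).isOpen).inter W₀.isOpen) ⟨(W N₁).toSubgroup.one_mem, W₀.toSubgroup.one_mem⟩
    have hW'triv : ∀ ⦃b⦄, b ∈ (W' : Subgroup G) → ∀ m : N, m * (φ b m)⁻¹ ∈ (N₂ N₁ : Subgroup N) :=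
      fun b hb m => hWtriv N₁ (hW' hb).1 m
    obtain ⟨M₀, hM₀⟩ := exists_openNormalSubgroup_twistedProd hc (N₂ N₁) W' (hN₂stab N₁) hW'triv
    -- `M₀ ≤ M'`, `M₀ ≤ M N₁`, `M₀ ≤ MW W'`
    have hM₀M' : M₀ ≤ M' := by
      intro g hg
      have hg' := (hM₀ g).mp hg
      exact hUsub g (hN₁U (hN₂le N₁ hg'.1)) (hW₀ (hW' hg'.2).2)
    have hM₀M : M₀ ≤ M N₁ := by
      intro g hg
      have hg' := (hM₀ g).mp hg
      exact (hM N₁ g).mpr ⟨hg'.1, (hW' hg'.2).1⟩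
    have hM₀MW : M₀ ≤ MW W' := by
      intro g hg
      have hg' := (hM₀ g).mp hg
      exact (hMW W' g).mpr ⟨show g.left ∈ (T : Subgroup N) by rw [hTtop]; exact Subgroup.mem_top _, hg'.2⟩
    set r' := (x M₀).out with hr'
    have hxM : x (M N₁) = (r' : (N ⋊[φ] G) ⧸ (M N₁).toSubgroup) := hx _ _ hM₀M r' (hrep _)
    have hxMW : x (MW W') = (r' : (N ⋊[φ] G) ⧸ (MW W').toSubgroup) := hx _ _ hM₀MW r' (hrep _)
    -- right parts: `r'.right⁻¹ k ∈ W'`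
    have hright : r'.right⁻¹ * k ∈ (W' : Subgroup G) := by
      have h := (hyrep W' r' hxMW).symm.trans (hk W')
      exact QuotientGroup.eq.mp h
    -- left parts: `r'.left⁻¹ n ∈ N₂ N₁`
    have hleft : r'.left⁻¹ * n ∈ (N₂ N₁ : Subgroup N) := by
      rw [hrep (M N₁), QuotientGroup.eq] at hxM
      have h1 := ((inv_mul_mem_iff_of_stable (B := (W N₁ : Subgroup G)) (hN₂stab N₁) _ _).mp
        ((hM N₁ _).mp hxM)).1
      have e : r'.left⁻¹ * n = (((x (M N₁)).out.left)⁻¹ * r'.left)⁻¹ * (((x (M N₁)).out.left)⁻¹ * n) := by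
        group
      rw [e]
      exact Subgroup.mul_mem _ (Subgroup.inv_mem _ h1) (hnN₂ N₁)
    -- hence `r'⁻¹ ⟨n, k⟩ ∈ M₀ ≤ M'`
    have hmem : x M₀ = ((⟨n, k⟩ : N ⋊[φ] G) : (N ⋊[φ] G) ⧸ M₀.toSubgroup) := by
      rw [hrep M₀, ← hr']
      apply QuotientGroup.eq.mpr
      exact (hM₀ _).mpr
        ((inv_mul_mem_iff_of_stable (B := (W' : Subgroup G)) (hN₂stab N₁) r' ⟨n, k⟩).mpr ⟨hleft, hright⟩)
    exact hx _ _ hM₀M' _ hmem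

end Literature.AnabelianGeometry.EtaleTheta.SettingModel.Semidirect
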